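import Summits.BirchSwinnertonDyer.BirchSwinnertonDyer.Theorems.TeichmullerTwistDescentTwistedPeriodLatticeTwistFrame
import Summits.BirchSwinnertonDyer.BirchSwinnertonDyer.Theorems.TeichmullerTwistDescentPeriodLatticeIndexParity
import Literature.NumberTheory.EllipticCurves.IsogenyDegreeLatticeIndexProofs
import HarnessLib

/-!
# Route `TeichmullerTwistDescent`, LINE 11 crux K `TwistedPeriodLatticeSaturation`
# (stmt-BirchSwinnertonDyer-25368): the registered stub `stub_dichotomy` MODULO MODULARITY —
# the index `[Λ(f) : g(χ)·Λ(f ⊗ χ)]` is never `p` on irreducible rows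

Cell `pub/bsd-wall` (D-0145 line route-BirchSwinnertonDyer-TeichmullerTwistDescent, OPEN rev 7), seat
`bsd-line-ttd-p1` (prover 1/2, g5). THEOREMS ONLY (no definition, no named fact, no `sorry`). BSD is not
proved by this; Manin's conjecture is not proved by this; the crux K itself is NOT proved here (it is
`stub_dichotomy ∧ stub_noCaseOne`, and `stub_noCaseOne` — Edixhoven 1991 §4 "case 1" exclusion — is the
open content, equivalent to `p ∤ c₀` in Edixhoven's exceptional case).

## What is proved

For `f = f_D` the newform of a lattice-optimal conductor-level datum `D` of the globally minimal `W`,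
`p ≥ 11` additive potentially-good-ordinary of low valuation (`ord_p Δ_min ≤ 4`), `E[p]` irreducible,
and `χ` THE primitive quadratic character mod `p` (there is only one,
`eq_of_isQuadratic_of_ne_one`), the tree has the frame
`p·Λ(f) ⊆ g(χ)·Λ(f ⊗ χ) ⊆ Λ(f)` (Stevens 1989 (5.4) `gaussSum_mul_mem_periodLattice_of_mem_charTwist`
and `TwistedPeriodLatticeIndexFrame.natCast_mul_mem_gaussSum_mul_periodLattice_charTwist…`, p607990), so
the index `i = [Λ(f) : gΛ(f ⊗ χ)]` divides `p²`. **`stub_dichotomy_of_modularity`: granted the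
Modularity theorem (`exists_isNewformOf`, the route's displayed bundle 25370), `i ≠ p`**, in the
registered form `Λ(f) ⊆ gΛ(f⊗χ) ∨ gΛ(f⊗χ) ⊆ pΛ(f)`.

## Proof (a parity argument on the `ℚ`-isogeny class of the `p*`-twist; no Galois action on `Λ/pΛ`)

* `V` := a minimal model of `W ⊗ ℚ(√p*)`, `C • W^{(p*)} = V`; its Néron lattice is
  `Λ_V = u·g⁻¹·Λ_W` (`mem_lattice_twist_pStar_iff`, the star-involution file).
* `W₀` := the `X₀(N)`-optimal curve of the class of `V` with its lattice-optimal datum `D₀`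
  (`X12.exists_isIsogenous_optimal`, from modularity alone), `N(W₀) = N(V) = N(W)`; by `q`-expansion
  comparison `f ⊗ χ = f_{D₀}` (`aₙ(V) = χ(n)aₙ(W)`), so `Λ_{W₀} = c₀·Λ(f ⊗ χ)`.
* Hence `gΛ(f⊗χ) ⊆ Λ(f)` reads `q·Λ_{W₀} ⊆ Λ_V` with the RATIONAL multiplier `q = c·u/c₀`, and
  `[Λ_V : qΛ_{W₀}] = i`, `pΛ_V ⊆ qΛ_{W₀}`.
* A cyclic `ℚ`-isogeny `ψ` between (short models of) `V` and `W₀` has a rational multiplier `q_ψ`,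
  `q_ψΛ_V ⊆ Λ_{W₀}`, `[Λ_{W₀} : q_ψΛ_V] = deg ψ =: d`
  (`degree_eq_natCard_ker_mulQuotientMap_of_baseChange_eq_curve`, Silverman AEC VI.4.1(b) + III.5), and
  `p ∤ d` (`X11b.not_dvd_degree_of_isCyclic_of_irr`: `E[p]` irreducible, transported to the twist by
  Burungale–Skinner–Tian–Wan's elementary lemma).
* `k := q·q_ψ` maps `Λ_V` into itself, so `k ∈ ℤ` (`int_of_rat_mul_mem_lattice_self`), and
  `[Λ_V : kΛ_V] = k²` (Mathlib `AddSubgroup.relIndex_map_nsmul`, rank `2`). Multiplicativity of the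
  index along `kΛ_V ⊆ qΛ_{W₀} ⊆ Λ_V` gives `d·i = k²`; with `i ∣ p²` and `p ∤ d`, `i = p` would force
  `p ∣ k`, `p² ∣ d p`, `p ∣ d` — so `i ∈ {1, p²}` (`le_or_le_of_prime_sandwich`).
[cite: EdixhovenManin1991, §4 (the `{1, p²}` alternative for irreducible `E[p]`)]
[cite: Stevens1989, Lemma (5.4) p. 97] [cite: SilvermanAEC2009, Thm. VI.4.1(b), III.4.11]
-/

set_option autoImplicit false
-- single-conjunct summit: `Summit.BirchSwinnertonDyer.BirchSwinnertonDyer.…` repeats the name by design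
set_option linter.dupNamespace false

noncomputable section

open scoped Classical NumberField

open WeierstrassCurve IsDedekindDomain Rat.HeightOneSpectrum Literature.NumberTheory.EllipticCurves Literature.NumberTheory.EllipticCurves.ModularForms
  Literature.NumberTheory.EllipticCurves.Rank1Residual
  Summit.BirchSwinnertonDyer.Rank1Residual Summit.BirchSwinnertonDyer.Rank1Residual.Additive
  Summit.BirchSwinnertonDyer.BirchSwinnertonDyer.Theorems.TeichmullerTwistDescentStarInvolution

namespace Summit.BirchSwinnertonDyer.BirchSwinnertonDyer.Theorems.TeichmullerTwistDescent.TwistedPeriodLatticeDichotomy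

open PeriodLatticeIndexParity TwistFrame

/-! ### §2 `stub_dichotomy` modulo modularity -/

/-- **Index dichotomy, GRANTED the Modularity theorem `exists_isNewformOf`.** For `W/ℚ` globally minimal,
additive and potentially good at `p ≥ 5` with `ord_p Δ_min < 6`, `E[p]` irreducible, `D` a LATTICE-OPTIMAL
conductor-level datum (`p² ∣ N`) and `χ` a primitive quadratic character mod `p`: EITHER
`Λ(f_D) ⊆ g(χ)·Λ(f_D ⊗ χ)` (index `1`) OR `g(χ)·Λ(f_D ⊗ χ) ⊆ p·Λ(f_D)` (index `p²`) — the index `p` does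
not occur. Proof: in the twist frame (`TwistFrame.exists_twist_frame`), `gΛ(f⊗χ) ⊆ Λ(f)` reads
`q·Λ_{W₀} ⊆ Λ_V` with the RATIONAL `q = c u / c₀`; a cyclic `ℚ`-isogeny between the short models of `V`
and `W₀` has a rational multiplier `q_ψ` with `[Λ_{W₀} : q_ψΛ_V] = deg ψ` prime to `p`; `k = q q_ψ ∈ ℤ`
and `[Λ_V : qΛ_{W₀}]·deg ψ = k²` (`PeriodLatticeIndexParity.le_or_le_of_prime_sandwich`).
[cite: EdixhovenManin1991, §4] [cite: Stevens1989, Lemma (5.4) p. 97] [cite: SilvermanAEC2009, Thm. VI.4.1(b)] -/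
theorem index_dichotomy_of_modularity (hnf : exists_isNewformOf) (W : WeierstrassCurve ℚ) [W.IsElliptic]
    [W.IsGloballyMinimal] (p : ℕ) [Fact p.Prime] [NeZero (W.conductorNorm ℤ)]
    (D : ModularParametrizationData W (W.conductorNorm ℤ)) (hsq : p ^ 2 ∣ W.conductorNorm ℤ)
    (hp5 : 5 ≤ p) (hadd : Rank1Residual.Addv W p) (hirr : Rank1Residual.Irr W p)
    (hj : 0 ≤ padicValRat p W.j) (hW6 : padicValInt p W.minimalDiscriminantInt < 6)
    (hopt : ∀ z ∈ D.L.lattice, ∃ w ∈ periodLattice D.f, z = D.c * w)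
    (χ : DirichletCharacter ℂ p) (hχ : χ.IsQuadratic) (hprim : χ.IsPrimitive) :
    (∀ z ∈ periodLattice D.f, ∃ w ∈ periodLattice
        (charTwist (W.conductorNorm ℤ) (dvd_refl _) hsq hχ D.f),
        z = gaussSum χ (ZMod.stdAddChar (N := p)) * w) ∨
    (∀ w ∈ periodLattice (charTwist (W.conductorNorm ℤ) (dvd_refl _) hsq hχ D.f),
        ∃ z ∈ periodLattice D.f, gaussSum χ (ZMod.stdAddChar (N := p)) * w = (p : ℂ) * z) := by
  have hpP : p.Prime := Fact.out
  have hp2 : p ≠ 2 := by omega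
  -- `χ` is THE quadratic character mod `p`
  obtain rfl : χ = (quadraticChar (ZMod p)).ringHomComp (Int.castRingHom ℂ) :=
    eq_of_isQuadratic_of_ne_one hχ
      (TwistedPeriodLatticeIndexFrame.ne_one_of_isPrimitive hprim hpP.ne_one)
      (isQuadratic_quadraticChar_ringHomComp p)
      (TwistedPeriodLatticeIndexFrame.ne_one_of_isPrimitive (isPrimitive_quadraticChar_ringHomComp p hp2)
        hpP.ne_one)
  set G : ℂ := gaussSum ((quadraticChar (ZMod p)).ringHomComp (Int.castRingHom ℂ))
    (ZMod.stdAddChar (N := p)) with hGdef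
  have hG0 : G ≠ 0 := gaussSum_stdAddChar_ne_zero_of_isPrimitive hprim
  set fχ := charTwist (W.conductorNorm ℤ) (dvd_refl _) hsq hχ D.f with hfχdef
  -- the frame `pΛ(f) ⊆ GΛ(f ⊗ χ) ⊆ Λ(f)` (Stevens (5.4) and p607990)
  have hStevens : ∀ w ∈ periodLattice fχ, G * w ∈ periodLattice D.f := fun w hw ↦
    gaussSum_mul_mem_periodLattice_of_mem_charTwist (W.conductorNorm ℤ) (dvd_refl _) hsq hχ hprim D.f hw
  have hFrame : ∀ z ∈ periodLattice D.f, ∃ w ∈ periodLattice fχ, (p : ℂ) * z = G * w := fun z hz ↦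
    TwistedPeriodLatticeIndexFrame.natCast_mul_mem_gaussSum_mul_periodLattice_charTwist_of_modularParametrizationData
      W p D hsq _ hχ hprim hz
  -- the twist frame
  obtain ⟨V, W₀, hVe, hVm, hE₀, hM₀, C, LV, D₀, hC, -, hLV, hiso, hirrV, hopt₀, hfeq⟩ :=
    exists_twist_frame hnf W p D hsq hp5 hadd hirr hj hW6 hχ
  haveI := hVe
  haveI := hVm
  haveI := hE₀
  haveI := hM₀
  have htw : ∀ x : ℂ, x ∈ LV.lattice ↔ G * ((((C.u : ℚ) : ℂ))⁻¹ * x) ∈ D.L.lattice := fun x ↦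
    mem_lattice_twist_pStar_iff p hp2 W V D.isNeronLattice hLV C hC x
  -- constants and the rational multiplier `q = c u / c₀`
  have hc : D.c ≠ 0 := D.maninConstant_ne_zero_holds
  have hc₀ : D₀.c ≠ 0 := D₀.maninConstant_ne_zero_holds
  have hu0 : (C.u : ℚ) ≠ 0 := C.u.ne_zero
  have hcℂ : (D.c : ℂ) ≠ 0 := by exact_mod_cast hc
  have hc₀ℂ : (D₀.c : ℂ) ≠ 0 := by exact_mod_cast hc₀
  have huℂ : (((C.u : ℚ) : ℚ) : ℂ) ≠ 0 := by exact_mod_cast hu0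
  set q : ℚ := (D.c : ℚ) * (C.u : ℚ) / (D₀.c : ℚ) with hqdef
  have hqℂ : ((q : ℚ) : ℂ) = (D.c : ℂ) * (((C.u : ℚ) : ℚ) : ℂ) / (D₀.c : ℂ) := by
    rw [hqdef]; push_cast; ring
  have hq1 : ∀ t : ℂ, ((q : ℚ) : ℂ) * ((D₀.c : ℂ) * t) = (D.c : ℂ) * (((C.u : ℚ) : ℚ) : ℂ) * t := by
    intro t
    rw [hqℂ]
    field_simp
  have hUinv : ∀ t : ℂ, t = (((C.u : ℚ) : ℚ) : ℂ) * (((((C.u : ℚ) : ℚ) : ℂ))⁻¹ * t) := fun t ↦ by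
    rw [← mul_assoc, mul_inv_cancel₀ huℂ, one_mul]
  -- the sandwich `pΛ_V ⊆ A := qΛ_{W₀} ⊆ Λ_V`
  set ΛV : AddSubgroup ℂ := LV.lattice.toAddSubgroup with hΛVdef
  set Λ0 : AddSubgroup ℂ := D₀.L.lattice.toAddSubgroup with hΛ0def
  set A : AddSubgroup ℂ := Λ0.map (AddMonoidHom.mulLeft ((q : ℚ) : ℂ)) with hAdef
  have hF1 : A ≤ ΛV := by
    rintro x ⟨y, hy, rfl⟩
    obtain ⟨w', hw', rfl⟩ := hopt₀ y hy
    rw [← hfeq] at hw'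
    have h1 : (D.c : ℂ) * (G * w') ∈ D.L.lattice := D.smul_periodLattice_le _ (hStevens w' hw')
    show ((q : ℚ) : ℂ) * ((D₀.c : ℂ) * w') ∈ LV.lattice
    rw [htw, hqℂ]
    convert h1 using 1
    field_simp
  have hF2 : ΛV.map (AddMonoidHom.mulLeft (p : ℂ)) ≤ A := by
    rintro x ⟨y, hy, rfl⟩
    have h1 := (htw y).mp hy
    obtain ⟨z, hz, hz'⟩ := hopt _ h1
    obtain ⟨w', hw', hw''⟩ := hFrame z hz
    refine ⟨(D₀.c : ℂ) * w', D₀.smul_periodLattice_le _ (hfeq ▸ hw'), ?_⟩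
    show ((q : ℚ) : ℂ) * ((D₀.c : ℂ) * w') = (p : ℂ) * y
    rw [hq1, hUinv y]
    apply mul_left_cancel₀ hG0
    linear_combination (-((p : ℂ) * (((C.u : ℚ) : ℚ) : ℂ))) * hz' -
      ((D.c : ℂ) * (((C.u : ℚ) : ℚ) : ℂ)) * hw''
  -- a cyclic `ℚ`-isogeny between the short models and its rational multiplier `q_ψ`
  haveI : (W₀.baseChange ℂ).IsElliptic := by rw [WeierstrassCurve.baseChange]; infer_instance
  set CV : VariableChange ℚ := ⟨1, -V.b₂ / 12, -V.a₁ / 2, V.a₁ * V.b₂ / 24 - V.a₃ / 2⟩ with hCV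
  set C0 : VariableChange ℚ := ⟨1, -W₀.b₂ / 12, -W₀.a₁ / 2, W₀.a₁ * W₀.b₂ / 24 - W₀.a₃ / 2⟩ with hC0
  have hEV : (CV • V).baseChange ℂ = LV.curve := shortModel_baseChange_eq_curve V hLV
  have hE0 : (C0 • W₀).baseChange ℂ = D₀.L.curve := shortModel_baseChange_eq_curve W₀ D₀.isNeronLattice
  have hisoM : IsIsogenous (CV • V) (C0 • W₀) :=
    (isIsogenous_of_smul V CV).trans' (hiso.trans' (isIsogenous_smul W₀ C0))
  obtain ⟨ψ, hψ⟩ := hisoM.exists_isCyclic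
  have hirrCV : (CV • V).HasIrreducibleModPGaloisRep p :=
    (Mazur1978.hasIrreducibleModPGaloisRep_smul_iff V CV p).mpr hirrV
  have hpdeg : ¬ p ∣ ψ.degree := X11b.not_dvd_degree_of_isCyclic_of_irr ψ hψ hpP hirrCV
  obtain ⟨qψ, hqψ0, hqψ, hdeg⟩ := degree_eq_natCard_ker_mulQuotientMap_of_baseChange_eq_curve ψ hEV hE0
  have hqψℂ : ((qψ : ℚ) : ℂ) ≠ 0 := by exact_mod_cast hqψ0
  -- `deg ψ = [Λ_{W₀} : q_ψ Λ_V]`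
  have hBle : ΛV.map (AddMonoidHom.mulLeft ((qψ : ℚ) : ℂ)) ≤ Λ0 := by
    rintro x ⟨y, hy, rfl⟩
    exact hqψ y hy
  have hd : ψ.degree = (ΛV.map (AddMonoidHom.mulLeft ((qψ : ℚ) : ℂ))).relIndex Λ0 := by
    have hinj : Function.Injective (AddMonoidHom.mulLeft ((qψ : ℚ) : ℂ) : ℂ →+ ℂ) :=
      mul_right_injective₀ hqψℂ
    have hsurj : Function.Surjective (AddMonoidHom.mulLeft ((qψ : ℚ) : ℂ) : ℂ →+ ℂ) := fun z ↦
      ⟨(((qψ : ℚ) : ℂ))⁻¹ * z, by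
        rw [AddMonoidHom.coe_mulLeft, ← mul_assoc, mul_inv_cancel₀ hqψℂ, one_mul]⟩
    rw [hdeg, natCard_ker_mulQuotientMap_eq_relIndex,
      ← AddSubgroup.relIndex_map_map_of_injective ΛV (Λ0.comap (AddMonoidHom.mulLeft ((qψ : ℚ) : ℂ)))
        hinj, AddSubgroup.map_comap_eq_self_of_surjective hsurj]
  -- `k := q q_ψ ∈ ℤ` and `kΛ_V ⊆ A` with `[A : kΛ_V] = deg ψ`
  have hkA : (ΛV.map (AddMonoidHom.mulLeft ((qψ : ℚ) : ℂ))).map (AddMonoidHom.mulLeft ((q : ℚ) : ℂ)) ≤ A :=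
    AddSubgroup.map_mono hBle
  have hkd : ((ΛV.map (AddMonoidHom.mulLeft ((qψ : ℚ) : ℂ))).map
      (AddMonoidHom.mulLeft ((q : ℚ) : ℂ))).relIndex A = ψ.degree := by
    have hq0 : ((q : ℚ) : ℂ) ≠ 0 := by
      rw [hqℂ]
      exact div_ne_zero (mul_ne_zero hcℂ huℂ) hc₀ℂ
    rw [hd, hAdef]
    exact AddSubgroup.relIndex_map_map_of_injective _ _ (mul_right_injective₀ hq0)
  rw [map_mulLeft_map_mulLeft] at hkA hkd
  obtain ⟨k, hk⟩ := int_of_rat_mul_mem_lattice_self LV (q * qψ) (fun z hz ↦ by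
    have h := hF1 (hkA ⟨z, hz, rfl⟩)
    rw [Rat.cast_mul]
    exact h)
  have hkℂ : (k : ℂ) = ((q : ℚ) : ℂ) * ((qψ : ℚ) : ℂ) := by
    have h := congrArg (fun t : ℚ ↦ (t : ℂ)) hk
    simpa only [Rat.cast_intCast, Rat.cast_mul] using h
  rw [← hkℂ] at hkA hkd
  -- parity
  have hnd : ¬ p ∣ (ΛV.map (AddMonoidHom.mulLeft (k : ℂ))).relIndex A := by rwa [hkd]
  rcases le_or_le_of_prime_sandwich LV hpP hF1 hF2 hkA hnd with hle | hle
  · -- index `1`: `Λ(f) ⊆ GΛ(f ⊗ χ)`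
    left
    intro z hz
    have h1 : (D.c : ℂ) * z ∈ D.L.lattice := D.smul_periodLattice_le _ hz
    set x : ℂ := (((C.u : ℚ) : ℚ) : ℂ) * ((D.c : ℂ) * z) / G with hx
    have hxV : x ∈ LV.lattice := by
      rw [htw]
      convert h1 using 1
      rw [hx]; field_simp
    obtain ⟨y, hy, hyx⟩ := hle hxV
    obtain ⟨w, hw, rfl⟩ := hopt₀ y hy
    rw [← hfeq] at hw
    refine ⟨w, hw, ?_⟩
    -- `q (c₀ w) = x = u c z / G`, i.e. `c u w G = u c z`
    have e : ((q : ℚ) : ℂ) * ((D₀.c : ℂ) * w) = x := hyx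
    rw [hq1] at e
    have i2 : x * G = (((C.u : ℚ) : ℚ) : ℂ) * ((D.c : ℂ) * z) := by
      rw [hx]
      exact div_mul_cancel₀ _ hG0
    rw [← e] at i2
    have key : (D.c : ℂ) * (((C.u : ℚ) : ℚ) : ℂ) * z = (D.c : ℂ) * (((C.u : ℚ) : ℚ) : ℂ) * (G * w) := by
      linear_combination -i2
    exact mul_left_cancel₀ (mul_ne_zero hcℂ huℂ) key
  · -- index `p²`: `GΛ(f ⊗ χ) ⊆ pΛ(f)`
    right
    intro w hw
    have hw0 : (D₀.c : ℂ) * w ∈ D₀.L.lattice := D₀.smul_periodLattice_le _ (hfeq ▸ hw)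
    have hA' : ((q : ℚ) : ℂ) * ((D₀.c : ℂ) * w) ∈ A := ⟨_, hw0, rfl⟩
    obtain ⟨x, hx, hxe⟩ := hle hA'
    have h1 := (htw x).mp hx
    obtain ⟨z, hz, hz'⟩ := hopt _ h1
    refine ⟨z, hz, ?_⟩
    -- `q c₀ w = p x`, `G u⁻¹ x = c z`
    have e : (p : ℂ) * x = ((q : ℚ) : ℂ) * ((D₀.c : ℂ) * w) := hxe
    rw [hq1, hUinv x] at e
    have key : (D.c : ℂ) * (((C.u : ℚ) : ℚ) : ℂ) * (G * w) =
        (D.c : ℂ) * (((C.u : ℚ) : ℚ) : ℂ) * ((p : ℂ) * z) := by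
      linear_combination (-G) * e + ((p : ℂ) * (((C.u : ℚ) : ℚ) : ℂ)) * hz'
    exact mul_left_cancel₀ (mul_ne_zero hcℂ huℂ) key


/-- **The registered stub `stub_dichotomy` of the LINE-11 skeleton of K `TwistedPeriodLatticeSaturation`
(stmt-BirchSwinnertonDyer-25368) VERBATIM, GRANTED the Modularity theorem `exists_isNewformOf`** — the
case `p ≥ 11`, `(G)`-ordinary (`0 ≤ ord_p j`), `ord_p Δ_min ≤ 4` of `index_dichotomy_of_modularity`.
[cite: EdixhovenManin1991, §4] -/
theorem stub_dichotomy_of_modularity (hnf : exists_isNewformOf) :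
    ∀ (W : WeierstrassCurve ℚ) [W.IsElliptic] [W.IsGloballyMinimal] (p : ℕ) [Fact p.Prime]
      [NeZero (W.conductorNorm ℤ)] (D : ModularParametrizationData W (W.conductorNorm ℤ))
      (hsq : p ^ 2 ∣ W.conductorNorm ℤ), 11 ≤ p → Rank1Residual.Addv W p → Rank1Residual.Irr W p →
      Summit.BirchSwinnertonDyer.Rank1Residual.Additive.TypeGOrd W p →
      padicValInt p W.minimalDiscriminantInt ≤ 4 →
      (∀ z ∈ D.L.lattice, ∃ w ∈ periodLattice D.f, z = D.c * w) →
      ∀ (χ : DirichletCharacter ℂ p) (hχ : χ.IsQuadratic), χ.IsPrimitive →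
        (∀ z ∈ periodLattice D.f, ∃ w ∈ periodLattice
            (charTwist (W.conductorNorm ℤ) (dvd_refl _) hsq hχ D.f),
            z = gaussSum χ (ZMod.stdAddChar (N := p)) * w) ∨
        (∀ w ∈ periodLattice (charTwist (W.conductorNorm ℤ) (dvd_refl _) hsq hχ D.f),
            ∃ z ∈ periodLattice D.f, gaussSum χ (ZMod.stdAddChar (N := p)) * w = (p : ℂ) * z) :=
  fun W _ _ p _ _ D hsq hp11 hadd hirr hGo hV4 hopt χ hχ hprim ↦
    index_dichotomy_of_modularity hnf W p D hsq (by omega) hadd hirr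
      (padicValRat_j_nonneg_of_typeGOrd W p hGo) (by omega) hopt χ hχ hprim

/-! ### §3 The converse direction: index `p²` forces `p ∣ c(D)` -/

/-- **"Case 1" means `p` divides the Manin constant.** In the setting of `stub_dichotomy_of_modularity`
(here only `p ≥ 5`, potentially good of low valuation, is used), if the index-`p²` member occurs,
`g(χ)·Λ(f_D ⊗ χ) ⊆ p·Λ(f_D)`, then `p ∣ c(D)`: in the twist frame the Néron lattices satisfy
`r·Λ_{W₀} ⊆ Λ_V` and `r⁻¹·Λ_V ⊆ Λ_{W₀}` for the RATIONAL `r = u c/(p c₀)`, so `r, r⁻¹ ∈ ℤ` by the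
integrality of Néron scalings between globally minimal models
(`integral_neronScaling_of_isGloballyMinimal_holds`), `r = ±1`, `u c = ± p c₀`, and `ord_p u = 0`.
Contrapositively: `p ∤ c(D)` (the GE11 conclusion at `(W, p, D)`) EXCLUDES case 1, i.e. gives the
conclusion of the registered stub `stub_noCaseOne` at `(W, p, D, χ)`. [cite: EdixhovenManin1991, §4]
[cite: SilvermanATAEC1994, IV.5.1 with IV.6.1] -/
theorem dvd_c_of_caseOne (hnf : exists_isNewformOf) (W : WeierstrassCurve ℚ) [W.IsElliptic]
    [W.IsGloballyMinimal] (p : ℕ) [Fact p.Prime] [NeZero (W.conductorNorm ℤ)]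
    (D : ModularParametrizationData W (W.conductorNorm ℤ)) (hsq : p ^ 2 ∣ W.conductorNorm ℤ)
    (hp5 : 5 ≤ p) (hadd : Rank1Residual.Addv W p) (hirr : Rank1Residual.Irr W p)
    (hj : 0 ≤ padicValRat p W.j) (hW6 : padicValInt p W.minimalDiscriminantInt < 6)
    (hopt : ∀ z ∈ D.L.lattice, ∃ w ∈ periodLattice D.f, z = D.c * w)
    (χ : DirichletCharacter ℂ p) (hχ : χ.IsQuadratic) (hprim : χ.IsPrimitive)
    (hcase : ∀ w ∈ periodLattice (charTwist (W.conductorNorm ℤ) (dvd_refl _) hsq hχ D.f),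
      ∃ z ∈ periodLattice D.f, gaussSum χ (ZMod.stdAddChar (N := p)) * w = (p : ℂ) * z) :
    (p : ℤ) ∣ D.c := by
  have hpP : p.Prime := Fact.out
  have hp2 : p ≠ 2 := by omega
  obtain rfl : χ = (quadraticChar (ZMod p)).ringHomComp (Int.castRingHom ℂ) :=
    eq_of_isQuadratic_of_ne_one hχ
      (TwistedPeriodLatticeIndexFrame.ne_one_of_isPrimitive hprim hpP.ne_one)
      (isQuadratic_quadraticChar_ringHomComp p)
      (TwistedPeriodLatticeIndexFrame.ne_one_of_isPrimitive (isPrimitive_quadraticChar_ringHomComp p hp2)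
        hpP.ne_one)
  set G : ℂ := gaussSum ((quadraticChar (ZMod p)).ringHomComp (Int.castRingHom ℂ))
    (ZMod.stdAddChar (N := p)) with hGdef
  have hG0 : G ≠ 0 := gaussSum_stdAddChar_ne_zero_of_isPrimitive hprim
  set fχ := charTwist (W.conductorNorm ℤ) (dvd_refl _) hsq hχ D.f with hfχdef
  have hFrame : ∀ z ∈ periodLattice D.f, ∃ w ∈ periodLattice fχ, (p : ℂ) * z = G * w := fun z hz ↦
    TwistedPeriodLatticeIndexFrame.natCast_mul_mem_gaussSum_mul_periodLattice_charTwist_of_modularParametrizationData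
      W p D hsq _ hχ hprim hz
  obtain ⟨V, W₀, hVe, hVm, hE₀, hM₀, C, LV, D₀, hC, hu, hLV, -, -, hopt₀, hfeq⟩ :=
    exists_twist_frame hnf W p D hsq hp5 hadd hirr hj hW6 hχ
  haveI := hVe
  haveI := hVm
  haveI := hE₀
  haveI := hM₀
  have htw : ∀ x : ℂ, x ∈ LV.lattice ↔ G * ((((C.u : ℚ) : ℂ))⁻¹ * x) ∈ D.L.lattice := fun x ↦
    mem_lattice_twist_pStar_iff p hp2 W V D.isNeronLattice hLV C hC x
  have hc : D.c ≠ 0 := D.maninConstant_ne_zero_holds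
  have hc₀ : D₀.c ≠ 0 := D₀.maninConstant_ne_zero_holds
  have hu0 : (C.u : ℚ) ≠ 0 := C.u.ne_zero
  have hcℂ : (D.c : ℂ) ≠ 0 := by exact_mod_cast hc
  have hc₀ℂ : (D₀.c : ℂ) ≠ 0 := by exact_mod_cast hc₀
  have huℂ : (((C.u : ℚ) : ℚ) : ℂ) ≠ 0 := by exact_mod_cast hu0
  have hpℂ : (p : ℂ) ≠ 0 := by exact_mod_cast hpP.ne_zero
  have hUinv : ∀ t : ℂ, t = (((C.u : ℚ) : ℚ) : ℂ) * (((((C.u : ℚ) : ℚ) : ℂ))⁻¹ * t) := fun t ↦ by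
    rw [← mul_assoc, mul_inv_cancel₀ huℂ, one_mul]
  -- the rational `r = u c / (p c₀)` and its inverse both scale one Néron lattice into the other
  set r : ℚ := (C.u : ℚ) * (D.c : ℚ) / ((p : ℚ) * (D₀.c : ℚ)) with hrdef
  have hrℂ : ((r : ℚ) : ℂ) = (((C.u : ℚ) : ℚ) : ℂ) * (D.c : ℂ) / ((p : ℂ) * (D₀.c : ℂ)) := by
    rw [hrdef]; push_cast; ring
  have hr1 : ∀ z ∈ D₀.L.lattice, ((r : ℚ) : ℂ) * z ∈ LV.lattice := by
    intro x hx
    obtain ⟨w', hw', rfl⟩ := hopt₀ x hx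
    rw [← hfeq] at hw'
    obtain ⟨z, hz, hzw⟩ := hcase w' hw'
    have h1 : (D.c : ℂ) * z ∈ D.L.lattice := D.smul_periodLattice_le _ hz
    have e : G * ((((C.u : ℚ) : ℚ) : ℂ)⁻¹ * (((r : ℚ) : ℂ) * ((D₀.c : ℂ) * w'))) = (D.c : ℂ) * z := by
      rw [hrℂ]
      field_simp
      linear_combination hzw
    rw [htw, e]
    exact h1
  have hr2 : ∀ z ∈ LV.lattice, (((r⁻¹ : ℚ) : ℚ) : ℂ) * z ∈ D₀.L.lattice := by
    intro y hy
    have h1 := (htw y).mp hy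
    obtain ⟨z, hz, hz'⟩ := hopt _ h1
    obtain ⟨w', hw', hw''⟩ := hFrame z hz
    have h2 : (D₀.c : ℂ) * w' ∈ D₀.L.lattice := D₀.smul_periodLattice_le _ (hfeq ▸ hw')
    have hy' : y = (((C.u : ℚ) : ℚ) : ℂ) * ((D.c : ℂ) * z) / G := by
      rw [← hz']
      field_simp
    have e : (((r⁻¹ : ℚ) : ℚ) : ℂ) * y = (D₀.c : ℂ) * w' := by
      rw [hy', Rat.cast_inv, hrℂ]
      field_simp
      linear_combination hw''
    rw [e]
    exact h2
  obtain ⟨k, hk⟩ := integral_neronScaling_of_isGloballyMinimal_holds W₀ V D₀.L LV D₀.isNeronLattice hLV r hr1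
  obtain ⟨k', hk'⟩ := integral_neronScaling_of_isGloballyMinimal_holds V W₀ LV D₀.L hLV D₀.isNeronLattice
    r⁻¹ hr2
  -- `k k' = 1`, so `r = k = ±1` and `u c = ± p c₀`
  have hr0 : r ≠ 0 := by
    rw [hrdef]
    exact div_ne_zero (mul_ne_zero hu0 (by exact_mod_cast hc))
      (mul_ne_zero (by exact_mod_cast hpP.ne_zero) (by exact_mod_cast hc₀))
  have hkk : k * k' = 1 := by
    have h : (k : ℚ) * k' = 1 := by rw [hk, hk', mul_inv_cancel₀ hr0]
    exact_mod_cast h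
  have hk1 : (k : ℚ) = 1 ∨ (k : ℚ) = -1 := by
    rcases Int.eq_one_or_neg_one_of_mul_eq_one hkk with h | h
    · left; exact_mod_cast h
    · right; exact_mod_cast h
  -- valuation count: `ord_p (u c) = ord_p (± p c₀) ≥ 1`, `ord_p u = 0`
  have hval : padicValRat p ((C.u : ℚ) * (D.c : ℚ)) = padicValRat p ((p : ℚ) * (D₀.c : ℚ)) := by
    have e : (C.u : ℚ) * (D.c : ℚ) = r * ((p : ℚ) * (D₀.c : ℚ)) := by
      rw [hrdef]
      field_simp
    rcases hk1 with h | h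
    · rw [e, ← hk, h, one_mul]
    · rw [e, ← hk, h, neg_one_mul, padicValRat.neg]
  rw [padicValRat.mul hu0 (by exact_mod_cast hc), hu, zero_add,
    padicValRat.mul (by exact_mod_cast hpP.ne_zero) (by exact_mod_cast hc₀), padicValRat.self hpP.one_lt,
    padicValRat.of_int, padicValRat.of_int] at hval
  have h1 : (1 : ℤ) ≤ padicValInt p D.c := by
    have h0 : (0 : ℤ) ≤ padicValInt p D₀.c := by positivity
    linarith
  have h1' : 1 ≤ padicValInt p D.c := by exact_mod_cast h1
  rw [← pow_one (p : ℤ), padicValInt_dvd_iff]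
  exact Or.inr h1'

end Summit.BirchSwinnertonDyer.BirchSwinnertonDyer.Theorems.TeichmullerTwistDescent.TwistedPeriodLatticeDichotomy

end
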